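import Literature.Barriers.CriticalPhenomena.PlaquetteWalkHoleRootWestCorridor
import Literature.Barriers.CriticalPhenomena.PlaquetteWalkHoleRootCorridor
import HarnessLib

/-!
# Barrier catalogue (SAWScalingLimit): LAW L FOR ALL BOXES — the corner-kill law of single-hole boxes as four theorems
quantified over the box and the hole, and the two kill-forced zeros

Leaf of `PlaquetteWalkHoleRootWestCorridor` and `PlaquetteWalkHoleRootCorridor` (the closed-corridor forms of the four
structural sign schemas). The venture lane's LAW L (pre-registered 2026-08-26, `FINDING-YB-KILL-FORCED-ZEROS.md` §5;
scored TRUE on 13 frames, 272/272 cells, by exact enumeration; its 44 predicted kills closed one frame at a time in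
`PlaquetteWalkHoleRootLawLCertified`, `…EastDeadEnd`, `…LawLTable`, `…Corridor`, `…WestCorridor`) says: in the box
`m × n` with one interior hole `h` at distance `≥ 2` from every side, rooted at the `W` side of `w = (h.1 + 1, h.2)` (the
hole's `E` side), far cell `f = (h.1 − 1, h.2)`, each of the four cells `K_S2 = (h.1 − 2, h.2 − 2)`,
`K_N1 = (h.1 − 2, h.2 + 2)`, `K_S1 = (h.1 + 2, h.2 − 2)`, `K_N2 = (h.1 + 2, h.2 + 2)`, WHEN IT IS A BOUNDARY CELL of the
box and is removed alone, kills one route of the far-cell defect at one hexagonal angle. Here the positive half of LAW L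
is proved for ALL boxes at once, at the level of the Yang–Baxter vertex functional (`boxMinus m n S` = the box minus the
listed cells):

* ★★★★★ `lawL_box_killSW_sign`: `2 ≤ h.1`, `h.1 + 3 ≤ m`, `2 ≤ h.2`, `h.2 + 3 ≤ n`, and `K_S2` on the boundary
  (`h.1 = 2 ∨ h.2 = 2`) ⇒ `Im VF(π/3; box ∖ {h, K_S2}) > 0`; `lawL_box_killNW_sign` (`K_N1`, `h.1 = 2 ∨ h.2 + 3 = n`
  ⇒ `Im VF(2π/3) < 0`); `lawL_box_killSE_sign` (`K_S1`, `h.1 + 3 = m ∨ h.2 = 2` ⇒ `Im VF(2π/3) > 0`);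
  `lawL_box_killNE_sign` (`K_N2`, `h.1 + 3 = m ∨ h.2 + 3 = n` ⇒ `Im VF(π/3) < 0`).
* ★★★★ `lawL_box_west_kills_exists_eq_zero` / `lawL_box_east_kills_exists_eq_zero`: both western (eastern) kill
  cells on the boundary, removed together ⇒ an exact zero of the vertex functional at the far cell in `(π/3, 2π/3)`.

MECHANISM: the 22-cell witness block sits inside the box because the hole is `≥ 2` from every side; the column clause is
the CLOSED-CORRIDOR clause with the corridor `R = D ∩ {x ≤ h.1 − 2, y ≤ h.2 − 3}` (resp. the three mirror images): on
the bottom / top wall `R = ∅`, on the west / east wall `R` is the wall column beyond the kill cell — a closed corridor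
whose only doors open onto the far cell's (the root plaquette's eastern neighbour's) column (`isCorridorSW_boxMinus`,
…). So the kill half of LAW L is ONE theorem per corner cell, for every box and every admissible hole — the 44 closed
rows of the table are its instances, and every larger box is covered without enumeration.

Not in print; venture lane «pcv-sawmu», seat b-step0 gen 26.

References: A. Glazman, I. Manolescu, arXiv:1708.00395v3, §1, §2.1, §4.2 and Lemma 2.1 [GlazmanManolescu2019];
A. Glazman, Electron. Commun. Probab. 20 (2015) no. 86, Lemma 3.1 [Glazman2015WeightedSAW]; R. Courant, H. Robbins,
*What is Mathematics?* (1941/1958), Ch. V Appendix §2 [CourantRobbins1958]; H. Duminil-Copin, S. Smirnov, Ann. of Math.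
175 (2012), Lemma 1 [DuminilCopinSmirnov2012].
-/

noncomputable section

open Set Function Complex

namespace Literature.Barriers.CriticalPhenomena.PlaquetteWalk

open Literature.Probability.RandomPlanarGeometry.SAW.YangBaxter
open Real Complex

/-! ## §1 Boxes minus a list of cells -/

section Boxes

/-- **The `m × n` box minus the listed cells** (`0 ≤ i < m`, `0 ≤ j < n`, `(i, j) ∉ S`), listed column by column.
[cite: GlazmanManolescu2019, §2.1 (finite domains of faces)] -/
def boxMinus (m n : ℕ) (S : List Face) : List Face :=
  ((List.range m).flatMap fun i => (List.range n).map fun j => (((i : ℕ) : ℤ), ((j : ℕ) : ℤ))).filter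
    fun f => decide (f ∉ S)

variable {m n : ℕ} {S : List Face}

/-- Membership in the box minus cells. [cite: GlazmanManolescu2019, §2.1 (finite domains of faces)] -/
theorem mem_boxMinus {f : Face} : f ∈ boxMinus m n S ↔ (0 ≤ f.1 ∧ f.1 < m ∧ 0 ≤ f.2 ∧ f.2 < n) ∧ f ∉ S := by
  obtain ⟨x, y⟩ := f
  simp only [boxMinus, List.mem_filter, List.mem_flatMap, List.mem_range, List.mem_map, Prod.mk.injEq,
    decide_eq_true_eq]
  constructor
  · rintro ⟨⟨i, hi, j, hj, rfl, rfl⟩, hS⟩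
    exact ⟨⟨by omega, by omega, by omega, by omega⟩, hS⟩
  · rintro ⟨⟨h1, h2, h3, h4⟩, hS⟩
    exact ⟨⟨x.toNat, by omega, y.toNat, by omega, by omega, by omega⟩, hS⟩

/-- Membership in the domain of the box minus cells. [cite: GlazmanManolescu2019, §2.1 (finite domains of faces)] -/
theorem mem_dom_boxMinus {f : Face} : f ∈ dom (boxMinus m n S) ↔ (0 ≤ f.1 ∧ f.1 < m ∧ 0 ≤ f.2 ∧ f.2 < n) ∧ f ∉ S :=
  mem_boxMinus

/-- A listed cell is absent. [cite: GlazmanManolescu2019, §2.1 (finite domains of faces)] -/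
theorem not_mem_dom_boxMinus_of_mem {f : Face} (hf : f ∈ S) : f ∉ dom (boxMinus m n S) :=
  fun h => (mem_dom_boxMinus.1 h).2 hf

end Boxes

/-! ## §2 The hole root of a box: hole, far cell, witness blocks -/

section HoleRoot

variable {m n : ℕ} {S : List Face} {h : Face}

/-- The hole of the root plaquette `(h.1 + 1, h.2)` is `h`. [cite: GlazmanManolescu2019, §1 (the lattice of rhombi and its mid-edges)] -/
theorem holeFaceW_hroot (h : Face) : holeFaceW (h.1 + 1, h.2) = h :=
  Prod.ext (by simp [holeFaceW]) (by simp [holeFaceW])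

/-- The cells of the west witness block, in coordinates (decided on the list).
[cite: GlazmanManolescu2019, §2.1 (finite domains of faces)] -/
theorem westBlock42_bounds : ∀ c ∈ westBlock42,
    1 ≤ c.1 ∧ c.1 ≤ 5 ∧ 0 ≤ c.2 ∧ c.2 ≤ 4 ∧ c ≠ (3, 2) ∧ c ≠ (1, 0) ∧ c ≠ (1, 4) := by
  decide

/-- The cells of the east witness block, in coordinates (decided on the list).
[cite: GlazmanManolescu2019, §2.1 (finite domains of faces)] -/
theorem eastBlock42_bounds : ∀ c ∈ eastBlock42,
    1 ≤ c.1 ∧ c.1 ≤ 5 ∧ 0 ≤ c.2 ∧ c.2 ≤ 4 ∧ c ≠ (3, 2) ∧ c ≠ (5, 0) ∧ c ≠ (5, 4) := by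
  decide

/-- **The west witness block sits inside the box** once the hole is `≥ 2` from every side and the removed cells are among
the hole and the two western kill cells. [cite: GlazmanManolescu2019, §2.1 (finite domains of faces), §4.2 (translation invariance)] -/
theorem westBlock_hroot_subset_boxMinus (hW : 2 ≤ h.1) (hE : h.1 + 3 ≤ m) (hS : 2 ≤ h.2) (hN : h.2 + 3 ≤ n)
    (hSl : ∀ s ∈ S, s = h ∨ s = killSW (h.1 + 1, h.2) ∨ s = killNW (h.1 + 1, h.2)) :
    ∀ c ∈ westBlock (h.1 + 1, h.2), c ∈ boxMinus m n S := by
  intro c hc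
  simp only [westBlock, List.mem_map] at hc
  obtain ⟨a, ha, rfl⟩ := hc
  obtain ⟨b1, b2, b3, b4, b5, b6, b7⟩ := westBlock42_bounds a ha
  obtain ⟨x, y⟩ := a
  simp only [ne_eq, Prod.mk.injEq, not_and] at b1 b2 b3 b4 b5 b6 b7
  rw [shiftBy_refShift_mk, mem_boxMinus]
  simp only
  refine ⟨⟨by omega, by omega, by omega, by omega⟩, fun hs => ?_⟩
  rcases hSl _ hs with e | e | e
  · have e' := Prod.ext_iff.1 e; simp only at e'; omega
  · have e' := Prod.ext_iff.1 e; simp only [killSW] at e'; omega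
  · have e' := Prod.ext_iff.1 e; simp only [killNW] at e'; omega

/-- **The east witness block sits inside the box** (removed cells among the hole and the two eastern kill cells).
[cite: GlazmanManolescu2019, §2.1 (finite domains of faces), §4.2 (translation invariance)] -/
theorem eastBlock_hroot_subset_boxMinus (hW : 2 ≤ h.1) (hE : h.1 + 3 ≤ m) (hS : 2 ≤ h.2) (hN : h.2 + 3 ≤ n)
    (hSl : ∀ s ∈ S, s = h ∨ s = killSE (h.1 + 1, h.2) ∨ s = killNE (h.1 + 1, h.2)) :
    ∀ c ∈ eastBlock (h.1 + 1, h.2), c ∈ boxMinus m n S := by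
  intro c hc
  simp only [eastBlock, List.mem_map] at hc
  obtain ⟨a, ha, rfl⟩ := hc
  obtain ⟨b1, b2, b3, b4, b5, b6, b7⟩ := eastBlock42_bounds a ha
  obtain ⟨x, y⟩ := a
  simp only [ne_eq, Prod.mk.injEq, not_and] at b1 b2 b3 b4 b5 b6 b7
  rw [shiftBy_refShift_mk, mem_boxMinus]
  simp only
  refine ⟨⟨by omega, by omega, by omega, by omega⟩, fun hs => ?_⟩
  rcases hSl _ hs with e | e | e
  · have e' := Prod.ext_iff.1 e; simp only at e'; omega
  · have e' := Prod.ext_iff.1 e; simp only [killSE] at e'; omega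
  · have e' := Prod.ext_iff.1 e; simp only [killNE] at e'; omega

end HoleRoot

/-! ## §3 The four closed corridors of a box -/

section BoxCorridors

variable {m n : ℕ} {S : List Face} {h : Face}

/-- **The south-western corridor of a box**: the cells `x ≤ h.1 − 2`, `y ≤ h.2 − 3` of the domain — empty when `K_S2`
lies on the bottom wall, the wall column below `K_S2` when it lies on the west wall — form a closed western corridor
below the kill row. [cite: CourantRobbins1958, Ch. V Appendix §2 (the even–odd rule)] -/
theorem isCorridorSW_boxMinus (hbdry : h.1 = 2 ∨ h.2 = 2) (hK : killSW (h.1 + 1, h.2) ∈ S) :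
    IsCorridorSW (h.1 + 1, h.2) (dom (boxMinus m n S))
      {c | c ∈ dom (boxMinus m n S) ∧ c.1 ≤ h.1 - 2 ∧ c.2 ≤ h.2 - 3} := by
  intro c hc
  simp only [Set.mem_setOf_eq] at hc
  obtain ⟨hcD, hc1, hc2⟩ := hc
  have hb := (mem_dom_boxMinus.1 hcD).1
  simp only [Set.mem_setOf_eq]
  refine ⟨by omega, fun hW' => ⟨hW', by omega, by omega⟩, fun hN' => ⟨hN', by omega, ?_⟩,
    fun hS' => ⟨hS', by omega, by omega⟩, fun hE' hnR => ?_⟩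
  · by_contra hlt
    rcases hbdry with e | e
    · refine (mem_dom_boxMinus.1 hN').2 ?_
      have ec : ((c.1, c.2 + 1) : Face) = killSW (h.1 + 1, h.2) :=
        Prod.ext (by simp only [killSW]; omega) (by simp only [killSW]; omega)
      rw [ec]; exact hK
    · omega
  · have h' : ¬(c.1 + 1 ≤ h.1 - 2 ∧ c.2 ≤ h.2 - 3) := fun hh => hnR ⟨hE', hh.1, hh.2⟩
    constructor <;> omega

/-- **The north-western corridor of a box** (cells `x ≤ h.1 − 2`, `y ≥ h.2 + 3`).
[cite: CourantRobbins1958, Ch. V Appendix §2 (the even–odd rule)] -/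
theorem isCorridorNW_boxMinus (hbdry : h.1 = 2 ∨ h.2 + 3 = n) (hK : killNW (h.1 + 1, h.2) ∈ S) :
    IsCorridorNW (h.1 + 1, h.2) (dom (boxMinus m n S))
      {c | c ∈ dom (boxMinus m n S) ∧ c.1 ≤ h.1 - 2 ∧ h.2 + 3 ≤ c.2} := by
  intro c hc
  simp only [Set.mem_setOf_eq] at hc
  obtain ⟨hcD, hc1, hc2⟩ := hc
  have hb := (mem_dom_boxMinus.1 hcD).1
  simp only [Set.mem_setOf_eq]
  refine ⟨by omega, fun hW' => ⟨hW', by omega, by omega⟩, fun hN' => ⟨hN', by omega, by omega⟩,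
    fun hS' => ⟨hS', by omega, ?_⟩, fun hE' hnR => ?_⟩
  · by_contra hlt
    rcases hbdry with e | e
    · refine (mem_dom_boxMinus.1 hS').2 ?_
      have ec : ((c.1, c.2 - 1) : Face) = killNW (h.1 + 1, h.2) :=
        Prod.ext (by simp only [killNW]; omega) (by simp only [killNW]; omega)
      rw [ec]; exact hK
    · have hb' := (mem_dom_boxMinus.1 hS').1
      simp only at hb'
      omega
  · have h' : ¬(c.1 + 1 ≤ h.1 - 2 ∧ h.2 + 3 ≤ c.2) := fun hh => hnR ⟨hE', hh.1, hh.2⟩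
    constructor <;> omega

/-- **The south-eastern corridor of a box** (cells `x ≥ h.1 + 2`, `y ≤ h.2 − 3`): a closed corridor below the kill row in
the sense of `PlaquetteWalkHoleRootCorridor`. [cite: CourantRobbins1958, Ch. V Appendix §2 (the even–odd rule)] -/
theorem isCorridorS_boxMinus (hbdry : h.1 + 3 = m ∨ h.2 = 2)
    (hK : killSE (h.1 + 1, h.2) ∈ S) :
    IsCorridorS (h.1 + 1, h.2) (dom (boxMinus m n S))
      {c | c ∈ dom (boxMinus m n S) ∧ h.1 + 2 ≤ c.1 ∧ c.2 ≤ h.2 - 3} := by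
  intro c hc
  simp only [Set.mem_setOf_eq] at hc
  obtain ⟨hcD, hc1, hc2⟩ := hc
  have hb := (mem_dom_boxMinus.1 hcD).1
  simp only [Set.mem_setOf_eq]
  refine ⟨by omega, fun hE' => ⟨hE', by omega, by omega⟩, fun hN' => ⟨hN', by omega, ?_⟩,
    fun hS' => ⟨hS', by omega, by omega⟩, fun hW' hnR => ?_⟩
  · by_contra hlt
    rcases hbdry with e | e
    · refine (mem_dom_boxMinus.1 hN').2 ?_
      have hb' := (mem_dom_boxMinus.1 hN').1
      simp only at hb'
      have ec : ((c.1, c.2 + 1) : Face) = killSE (h.1 + 1, h.2) :=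
        Prod.ext (by simp only [killSE]; omega) (by simp only [killSE]; omega)
      rw [ec]; exact hK
    · omega
  · have h' : ¬(h.1 + 2 ≤ c.1 - 1 ∧ c.2 ≤ h.2 - 3) := fun hh => hnR ⟨hW', hh.1, hh.2⟩
    constructor <;> omega

/-- **The north-eastern corridor of a box** (cells `x ≥ h.1 + 2`, `y ≥ h.2 + 3`).
[cite: CourantRobbins1958, Ch. V Appendix §2 (the even–odd rule)] -/
theorem isCorridorN_boxMinus (hbdry : h.1 + 3 = m ∨ h.2 + 3 = n)
    (hK : killNE (h.1 + 1, h.2) ∈ S) :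
    IsCorridorN (h.1 + 1, h.2) (dom (boxMinus m n S))
      {c | c ∈ dom (boxMinus m n S) ∧ h.1 + 2 ≤ c.1 ∧ h.2 + 3 ≤ c.2} := by
  intro c hc
  simp only [Set.mem_setOf_eq] at hc
  obtain ⟨hcD, hc1, hc2⟩ := hc
  have hb := (mem_dom_boxMinus.1 hcD).1
  simp only [Set.mem_setOf_eq]
  refine ⟨by omega, fun hE' => ⟨hE', by omega, by omega⟩, fun hN' => ⟨hN', by omega, by omega⟩,
    fun hS' => ⟨hS', by omega, ?_⟩, fun hW' hnR => ?_⟩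
  · by_contra hlt
    rcases hbdry with e | e
    · refine (mem_dom_boxMinus.1 hS').2 ?_
      have hb' := (mem_dom_boxMinus.1 hS').1
      simp only at hb'
      have ec : ((c.1, c.2 - 1) : Face) = killNE (h.1 + 1, h.2) :=
        Prod.ext (by simp only [killNE]; omega) (by simp only [killNE]; omega)
      rw [ec]; exact hK
    · have hb' := (mem_dom_boxMinus.1 hS').1
      simp only at hb'
      omega
  · have h' : ¬(h.1 + 2 ≤ c.1 - 1 ∧ h.2 + 3 ≤ c.2) := fun hh => hnR ⟨hW', hh.1, hh.2⟩
    constructor <;> omega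

end BoxCorridors

/-! ## §4 LAW L for all boxes: the four signs -/

section Signs

variable {m n : ℕ} {h : Face}

/-- ★★★★★ **LAW L, `K_S2`, ALL BOXES**: in the `m × n` box with the hole `h` at distance `≥ 2` from every side, if
`K_S2 = (h.1 − 2, h.2 − 2)` is a boundary cell (`h.1 = 2`: west wall, any height; `h.2 = 2`: bottom wall) then removing it
alone makes the imaginary part of the Yang–Baxter vertex functional of the hole root (root `W` side of `(h.1 + 1, h.2)`)
at the far cell `(h.1 − 1, h.2)` STRICTLY POSITIVE at `θ = π/3` (the under route is `w₂`-killed, the over route free).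
[cite: GlazmanManolescu2019, Lemma 2.1 (statement, "in the form given in [Gl]"), §2.1, §4.2]
[cite: GlazmanManolescu2019, §1 (the paragraph of Fig. 2: «if θ = π/3, then w₂ = 0»)] [cite: CourantRobbins1958, Ch. V Appendix §2 (the even–odd rule)] -/
theorem lawL_box_killSW_sign (hW : 2 ≤ h.1) (hE : h.1 + 3 ≤ m) (hS : 2 ≤ h.2) (hN : h.2 + 3 ≤ n)
    (hbdry : h.1 = 2 ∨ h.2 = 2) :
    0 < (vertexFunctional (printedWeights (π / 3)) tFiveEighths (ybCoeff (π / 3))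
      (boxMinus m n [h, killSW (h.1 + 1, h.2)]) (Face.side (h.1 + 1, h.2) .W) (farW (h.1 + 1, h.2))).im := by
  refine im_vertexFunctional_printed_pi_div_three_pos_of_killSW_corridor
    (westBlock_hroot_subset_boxMinus hW hE hS hN fun s hs => ?_) ?_
    (not_mem_dom_boxMinus_of_mem (by simp))
    (isCorridorSW_boxMinus hbdry (by simp)) fun y hy => ?_
  · simp only [List.mem_cons, List.not_mem_nil, or_false] at hs
    rcases hs with e | e
    · exact Or.inl e
    · exact Or.inr (Or.inl e)
  · rw [holeFaceW_hroot]; exact not_mem_dom_boxMinus_of_mem (by simp)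
  · simp only at hy ⊢
    by_cases hD : ((h.1 + 1 - 3, y) : Face) ∈ dom (boxMinus m n [h, killSW (h.1 + 1, h.2)])
    · right; right; simp only [Set.mem_setOf_eq]; exact ⟨hD, by omega, by omega⟩
    · exact Or.inl hD

/-- ★★★★★ **LAW L, `K_N1`, ALL BOXES**: `K_N1 = (h.1 − 2, h.2 + 2)` on the boundary (`h.1 = 2` or `h.2 + 3 = n`),
removed alone ⇒ `Im VF(2π/3) < 0` at the far cell (the over route is `w₁`-killed, the under route free).
[cite: GlazmanManolescu2019, Lemma 2.1 (statement, "in the form given in [Gl]"), §2.1, §4.2]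
[cite: GlazmanManolescu2019, §1, remark after eq. (1)] [cite: CourantRobbins1958, Ch. V Appendix §2 (the even–odd rule)] -/
theorem lawL_box_killNW_sign (hW : 2 ≤ h.1) (hE : h.1 + 3 ≤ m) (hS : 2 ≤ h.2) (hN : h.2 + 3 ≤ n)
    (hbdry : h.1 = 2 ∨ h.2 + 3 = n) :
    (vertexFunctional (printedWeights (2 * π / 3)) tFiveEighths (ybCoeff (2 * π / 3))
      (boxMinus m n [h, killNW (h.1 + 1, h.2)]) (Face.side (h.1 + 1, h.2) .W) (farW (h.1 + 1, h.2))).im < 0 := by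
  refine im_vertexFunctional_printed_two_pi_div_three_neg_of_killNW_corridor
    (westBlock_hroot_subset_boxMinus hW hE hS hN fun s hs => ?_) ?_
    (not_mem_dom_boxMinus_of_mem (by simp))
    (isCorridorNW_boxMinus hbdry (by simp)) fun y hy => ?_
  · simp only [List.mem_cons, List.not_mem_nil, or_false] at hs
    rcases hs with e | e
    · exact Or.inl e
    · exact Or.inr (Or.inr e)
  · rw [holeFaceW_hroot]; exact not_mem_dom_boxMinus_of_mem (by simp)
  · simp only at hy ⊢
    by_cases hD : ((h.1 + 1 - 3, y) : Face) ∈ dom (boxMinus m n [h, killNW (h.1 + 1, h.2)])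
    · right; right; simp only [Set.mem_setOf_eq]; exact ⟨hD, by omega, by omega⟩
    · exact Or.inl hD

/-- ★★★★★ **LAW L, `K_S1`, ALL BOXES**: `K_S1 = (h.1 + 2, h.2 − 2)` on the boundary (`h.1 + 3 = m`: east wall, any
height; or `h.2 = 2`), removed alone ⇒ `Im VF(2π/3) > 0` at the far cell (the under route is `w₁`-killed).
[cite: GlazmanManolescu2019, Lemma 2.1 (statement, "in the form given in [Gl]"), §2.1, §4.2]
[cite: GlazmanManolescu2019, §1, remark after eq. (1)] [cite: CourantRobbins1958, Ch. V Appendix §2 (the even–odd rule)] -/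
theorem lawL_box_killSE_sign (hW : 2 ≤ h.1) (hE : h.1 + 3 ≤ m) (hS : 2 ≤ h.2) (hN : h.2 + 3 ≤ n)
    (hbdry : h.1 + 3 = m ∨ h.2 = 2) :
    0 < (vertexFunctional (printedWeights (2 * π / 3)) tFiveEighths (ybCoeff (2 * π / 3))
      (boxMinus m n [h, killSE (h.1 + 1, h.2)]) (Face.side (h.1 + 1, h.2) .W) (farW (h.1 + 1, h.2))).im := by
  refine im_vertexFunctional_printed_two_pi_div_three_pos_of_killSE_corridor
    (eastBlock_hroot_subset_boxMinus hW hE hS hN fun s hs => ?_) ?_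
    (not_mem_dom_boxMinus_of_mem (by simp))
    (isCorridorS_boxMinus hbdry (by simp)) fun y hy => ?_
  · simp only [List.mem_cons, List.not_mem_nil, or_false] at hs
    rcases hs with e | e
    · exact Or.inl e
    · exact Or.inr (Or.inl e)
  · rw [holeFaceW_hroot]; exact not_mem_dom_boxMinus_of_mem (by simp)
  · simp only at hy ⊢
    by_cases hD : ((h.1 + 1 + 1, y) : Face) ∈ dom (boxMinus m n [h, killSE (h.1 + 1, h.2)])
    · right; right; simp only [Set.mem_setOf_eq]; exact ⟨hD, by omega, by omega⟩
    · exact Or.inr (Or.inl hD)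

/-- ★★★★★ **LAW L, `K_N2`, ALL BOXES**: `K_N2 = (h.1 + 2, h.2 + 2)` on the boundary (`h.1 + 3 = m` or `h.2 + 3 = n`),
removed alone ⇒ `Im VF(π/3) < 0` at the far cell (the over route is `w₂`-killed).
[cite: GlazmanManolescu2019, Lemma 2.1 (statement, "in the form given in [Gl]"), §2.1, §4.2]
[cite: GlazmanManolescu2019, §1 (the paragraph of Fig. 2)] [cite: CourantRobbins1958, Ch. V Appendix §2 (the even–odd rule)] -/
theorem lawL_box_killNE_sign (hW : 2 ≤ h.1) (hE : h.1 + 3 ≤ m) (hS : 2 ≤ h.2) (hN : h.2 + 3 ≤ n)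
    (hbdry : h.1 + 3 = m ∨ h.2 + 3 = n) :
    (vertexFunctional (printedWeights (π / 3)) tFiveEighths (ybCoeff (π / 3))
      (boxMinus m n [h, killNE (h.1 + 1, h.2)]) (Face.side (h.1 + 1, h.2) .W) (farW (h.1 + 1, h.2))).im < 0 := by
  refine im_vertexFunctional_printed_pi_div_three_neg_of_killNE_corridor
    (eastBlock_hroot_subset_boxMinus hW hE hS hN fun s hs => ?_) ?_
    (not_mem_dom_boxMinus_of_mem (by simp))
    (isCorridorN_boxMinus hbdry (by simp)) fun y hy => ?_
  · simp only [List.mem_cons, List.not_mem_nil, or_false] at hs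
    rcases hs with e | e
    · exact Or.inl e
    · exact Or.inr (Or.inr e)
  · rw [holeFaceW_hroot]; exact not_mem_dom_boxMinus_of_mem (by simp)
  · simp only at hy ⊢
    by_cases hD : ((h.1 + 1 + 1, y) : Face) ∈ dom (boxMinus m n [h, killNE (h.1 + 1, h.2)])
    · right; right; simp only [Set.mem_setOf_eq]; exact ⟨hD, by omega, by omega⟩
    · exact Or.inr (Or.inl hD)

end Signs

/-! ## §5 LAW L for all boxes: the two kill-forced zeros -/

section Zeros

variable {m n : ℕ} {h : Face}

/-- The far cell lies in the box minus the hole and kill cells. [cite: GlazmanManolescu2019, §2.1 (finite domains of faces)] -/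
theorem farW_hroot_mem_boxMinus {S : List Face} (hW : 2 ≤ h.1) (hE : h.1 + 3 ≤ m) (hS : 2 ≤ h.2) (hN : h.2 + 3 ≤ n)
    (hSl : ∀ s ∈ S, s = h ∨ s.2 ≠ h.2) : farW (h.1 + 1, h.2) ∈ boxMinus m n S := by
  rw [mem_boxMinus]
  simp only [farW]
  refine ⟨⟨by omega, by omega, by omega, by omega⟩, fun hs => ?_⟩
  rcases hSl _ hs with e | e
  · have e' := Prod.ext_iff.1 e; simp only at e'; omega
  · exact e rfl

/-- ★★★★ **LAW L's WESTERN KILL-FORCED ZERO, ALL BOXES**: the hole `≥ 2` from every side, both western kill cells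
`K_S2`, `K_N1` boundary cells of the box (`h.1 = 2`, or a box of height `5` around the hole's row), removed together ⇒ the
Yang–Baxter vertex functional of the hole root vanishes at the far cell for some `θ ∈ (π/3, 2π/3)`.
[cite: GlazmanManolescu2019, Lemma 2.1 (statement, "in the form given in [Gl]"), §4.2]
[cite: GlazmanManolescu2019, §1 (the paragraph of Fig. 2 and the remark after eq. (1))]
[cite: DuminilCopinSmirnov2012, proof of Lemma 1] [cite: CourantRobbins1958, Ch. V Appendix §2 (the even–odd rule)] -/
theorem lawL_box_west_kills_exists_eq_zero (hW : 2 ≤ h.1) (hE : h.1 + 3 ≤ m) (hS : 2 ≤ h.2) (hN : h.2 + 3 ≤ n)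
    (hbdryS : h.1 = 2 ∨ h.2 = 2) (hbdryN : h.1 = 2 ∨ h.2 + 3 = n) :
    ∃ θ ∈ Set.Ioo (π / 3) (2 * π / 3),
      vertexFunctional (printedWeights θ) tFiveEighths (ybCoeff θ)
        (boxMinus m n [h, killSW (h.1 + 1, h.2), killNW (h.1 + 1, h.2)]) (Face.side (h.1 + 1, h.2) .W)
          (farW (h.1 + 1, h.2)) = 0 := by
  set S : List Face := [h, killSW (h.1 + 1, h.2), killNW (h.1 + 1, h.2)] with hSdef
  have hSl : ∀ s ∈ S, s = h ∨ s = killSW (h.1 + 1, h.2) ∨ s = killNW (h.1 + 1, h.2) := fun s hs => by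
    simpa [hSdef] using hs
  have hB := westBlock_hroot_subset_boxMinus (m := m) (n := n) hW hE hS hN hSl
  have hh : holeFaceW (h.1 + 1, h.2) ∉ dom (boxMinus m n S) := by
    rw [holeFaceW_hroot]; exact not_mem_dom_boxMinus_of_mem (by simp [hSdef])
  have hf : farW (h.1 + 1, h.2) ∈ boxMinus m n S :=
    farW_hroot_mem_boxMinus hW hE hS hN fun s hs => by
      rcases hSl s hs with e | e | e
      · exact Or.inl e
      · right; rw [e]; simp only [killSW]; omega
      · right; rw [e]; simp only [killNW]; omega
  refine vertexFunctional_printed_farCellW_exists_eq_zero_Ioo_of_im_pos_of_im_neg (by linarith [Real.pi_pos])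
    ⟨le_rfl, by linarith [Real.pi_pos]⟩ ⟨by linarith [Real.pi_pos], le_rfl⟩ _ (h.1 + 1, h.2) hf hh ?_ ?_
  · refine im_vertexFunctional_printed_pi_div_three_pos_of_killSW_corridor hB hh
      (not_mem_dom_boxMinus_of_mem (by simp [hSdef])) (isCorridorSW_boxMinus hbdryS (by simp [hSdef]))
      fun y hy => ?_
    simp only at hy ⊢
    by_cases hD : ((h.1 + 1 - 3, y) : Face) ∈ dom (boxMinus m n S)
    · right; right; simp only [Set.mem_setOf_eq]; exact ⟨hD, by omega, by omega⟩
    · exact Or.inl hD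
  · refine im_vertexFunctional_printed_two_pi_div_three_neg_of_killNW_corridor hB hh
      (not_mem_dom_boxMinus_of_mem (by simp [hSdef])) (isCorridorNW_boxMinus hbdryN (by simp [hSdef]))
      fun y hy => ?_
    simp only at hy ⊢
    by_cases hD : ((h.1 + 1 - 3, y) : Face) ∈ dom (boxMinus m n S)
    · right; right; simp only [Set.mem_setOf_eq]; exact ⟨hD, by omega, by omega⟩
    · exact Or.inl hD

/-- ★★★★ **LAW L's EASTERN KILL-FORCED ZERO, ALL BOXES**: both eastern kill cells `K_S1`, `K_N2` boundary cells
(`h.1 + 3 = m`, or height `5` around the hole's row), removed together ⇒ an exact zero at the far cell in `(π/3, 2π/3)`.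
[cite: GlazmanManolescu2019, Lemma 2.1 (statement, "in the form given in [Gl]"), §4.2]
[cite: GlazmanManolescu2019, §1 (the paragraph of Fig. 2 and the remark after eq. (1))]
[cite: DuminilCopinSmirnov2012, proof of Lemma 1] [cite: CourantRobbins1958, Ch. V Appendix §2 (the even–odd rule)] -/
theorem lawL_box_east_kills_exists_eq_zero (hW : 2 ≤ h.1) (hE : h.1 + 3 ≤ m) (hS : 2 ≤ h.2) (hN : h.2 + 3 ≤ n)
    (hbdryS : h.1 + 3 = m ∨ h.2 = 2) (hbdryN : h.1 + 3 = m ∨ h.2 + 3 = n) :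
    ∃ θ ∈ Set.Ioo (π / 3) (2 * π / 3),
      vertexFunctional (printedWeights θ) tFiveEighths (ybCoeff θ)
        (boxMinus m n [h, killSE (h.1 + 1, h.2), killNE (h.1 + 1, h.2)]) (Face.side (h.1 + 1, h.2) .W)
          (farW (h.1 + 1, h.2)) = 0 := by
  set S : List Face := [h, killSE (h.1 + 1, h.2), killNE (h.1 + 1, h.2)] with hSdef
  have hSl : ∀ s ∈ S, s = h ∨ s = killSE (h.1 + 1, h.2) ∨ s = killNE (h.1 + 1, h.2) := fun s hs => by
    simpa [hSdef] using hs
  have hB := eastBlock_hroot_subset_boxMinus (m := m) (n := n) hW hE hS hN hSl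
  have hh : holeFaceW (h.1 + 1, h.2) ∉ dom (boxMinus m n S) := by
    rw [holeFaceW_hroot]; exact not_mem_dom_boxMinus_of_mem (by simp [hSdef])
  have hf : farW (h.1 + 1, h.2) ∈ boxMinus m n S :=
    farW_hroot_mem_boxMinus hW hE hS hN fun s hs => by
      rcases hSl s hs with e | e | e
      · exact Or.inl e
      · right; rw [e]; simp only [killSE]; omega
      · right; rw [e]; simp only [killNE]; omega
  refine vertexFunctional_printed_farCellW_exists_eq_zero_Ioo_of_im_neg_of_im_pos (by linarith [Real.pi_pos])
    ⟨le_rfl, by linarith [Real.pi_pos]⟩ ⟨by linarith [Real.pi_pos], le_rfl⟩ _ (h.1 + 1, h.2) hf hh ?_ ?_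
  · refine im_vertexFunctional_printed_pi_div_three_neg_of_killNE_corridor hB hh
      (not_mem_dom_boxMinus_of_mem (by simp [hSdef])) (isCorridorN_boxMinus hbdryN (by simp [hSdef]))
      fun y hy => ?_
    simp only at hy ⊢
    by_cases hD : ((h.1 + 1 + 1, y) : Face) ∈ dom (boxMinus m n S)
    · right; right; simp only [Set.mem_setOf_eq]; exact ⟨hD, by omega, by omega⟩
    · exact Or.inr (Or.inl hD)
  · refine im_vertexFunctional_printed_two_pi_div_three_pos_of_killSE_corridor hB hh
      (not_mem_dom_boxMinus_of_mem (by simp [hSdef])) (isCorridorS_boxMinus hbdryS (by simp [hSdef]))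
      fun y hy => ?_
    simp only at hy ⊢
    by_cases hD : ((h.1 + 1 + 1, y) : Face) ∈ dom (boxMinus m n S)
    · right; right; simp only [Set.mem_setOf_eq]; exact ⟨hD, by omega, by omega⟩
    · exact Or.inr (Or.inl hD)

end Zeros

/-! ## §6 Instances: two rows of the table, and a box beyond it -/

section Instances

/-- LAW L frame `57b` (`5×7 ∖ (2,2)`), cell `(0,4)` = `K_N1`, as an instance of the all-boxes theorem (the west-wall case
at height `4`; compare `frame57b_KN1_sign`). [cite: GlazmanManolescu2019, Lemma 2.1 (statement, "in the form given in [Gl]")] -/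
theorem box57_hole22_killNW_sign : (vertexFunctional (printedWeights (2 * π / 3)) tFiveEighths (ybCoeff (2 * π / 3))
    (boxMinus 5 7 [((2 : ℤ), (2 : ℤ)), killNW ((2 : ℤ) + 1, (2 : ℤ))]) (Face.side ((2 : ℤ) + 1, (2 : ℤ)) .W)
      (farW ((2 : ℤ) + 1, (2 : ℤ)))).im < 0 :=
  lawL_box_killNW_sign (h := ((2 : ℤ), (2 : ℤ))) (m := 5) (n := 7) (by decide) (by decide) (by decide) (by decide)
    (Or.inl rfl)

/-- LAW L beyond the table: the `12 × 9` box with the hole `(2, 5)` — `K_S2 = (0, 3)` on the west wall with a three-cell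
corridor `(0,0), (0,1), (0,2)` below it ⇒ `Im VF(π/3) > 0`. [cite: GlazmanManolescu2019, Lemma 2.1 (statement, "in the form given in [Gl]")] -/
theorem box12x9_hole25_killSW_sign : 0 < (vertexFunctional (printedWeights (π / 3)) tFiveEighths (ybCoeff (π / 3))
    (boxMinus 12 9 [((2 : ℤ), (5 : ℤ)), killSW ((2 : ℤ) + 1, (5 : ℤ))]) (Face.side ((2 : ℤ) + 1, (5 : ℤ)) .W)
      (farW ((2 : ℤ) + 1, (5 : ℤ)))).im :=
  lawL_box_killSW_sign (h := ((2 : ℤ), (5 : ℤ))) (m := 12) (n := 9) (by decide) (by decide) (by decide) (by decide)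
    (Or.inl rfl)

end Instances

end Literature.Barriers.CriticalPhenomena.PlaquetteWalk
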